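import Mathlib
import Literature.MathematicalPhysics.QuantumFieldTheory.Balaban1983to89.B5Transfer133

/-!
# B5 p. 39: Proposition 1.2 for G from Proposition 1.2 for G₀ by the identity (1.132) — the steps S2∘S1

Paper **B5** = T. Bałaban, *Propagators and renormalization transformations for lattice gauge theories. I*,
Comm. Math. Phys. **95** (1984) 17–40 [cite: Balaban1984PropagatorsI].  Journal page = PDF page + 16.
[2] = **B4** = T. Bałaban, *Regularity and decay of lattice Green's functions*, Comm. Math. Phys. **89** (1983)
571–597 [cite: Balaban1983RegularityDecay].

## What the paper prints (verbatim, from the page renders)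

p. 39 [PDF 23]: «Thus we have to prove inequalities (1.115)–(1.117). Let us notice that the proof of inequalities
(1.114), describing the decay in L²-norms, is completed because we have proved inequalities (1.89). This may serve
as a basis of another proof of the exponential decay properties. This proof, and also a proof of (1.115)–(1.117),
makes use of the identity G = G₀ + G₀∂P∂*G, (1.132) where G₀ = (Δ + aQ*Q)^{−1}. This operator is similar to G′,
but with the different averaging operator. We will prove (1.115)–(1.117), and in fact the whole Proposition 1.2,
for the operator G₀. This together with the properties (1.126), (1.127) of ∂P∂* and (1.89), or (1.114) for the
operator G implies immediately (1.115)–(1.117), or Proposition 1.2 for G.»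

p. 38 [PDF 22]: «Let us write bounds for the operator ∂P∂*. They follow from the representation
P = G′Q′*(Q′G′²Q′*)^{−1}Q′G′, from Lemma 2.4 of [2], and the representation (1.45) and the analyticity method of
proving an exponential decay (see the proof of Lemma 2.4 in [2]). We obtain
|(∂P∂*)_{μ,ν}(x, x′)| ≤ O(1)e^{−δ′₀|x−x′|}, (1.126)» … «The constant O(1) in (1.126) depends on d only, and in
(1.127) it depends on α also (O(1) → ∞ if α → 1).»  ((1.126)–(1.127) are typed verbatim as the LEAF
`B5.Kernel126_127Printed`; Proposition 1.2 itself, (1.110)–(1.114) pp. 35–36, as `B5.Prop12Printed`.)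

## What this module does (kernel-checked) and what it does NOT do

`B5.prop12_of_printed_steps` (and `B5FromB4.prop12_of_B4`) type the p. 39 sentence as the pair of NAMED slots
`S2 : B5.Prop12Printed famG0 → B5.Kernel126_127Printed K → B5.Local114Fam fam → B5.Global115_117Fam fam g` and
`S1 : B5.Global115_117Fam fam g → B5.Prop11Printed fam → B5.Kernel126_127Printed K → B5.Prop12Printed fam`
(the first of the two printed pairings, «(1.89) … (1.115)–(1.117)», followed by the random-walk step of p. 36).
The sentence also prints the SECOND pairing — «(1.114) for the operator G implies immediately … Proposition 1.2 for
G» — and that one is arithmetic over the identity (1.132) applied entrywise.  Here it is DERIVED: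

`prop12_of_G0_via132 :
  … → B5.Prop12Printed famG0 → B5.Kernel126_127Printed Kd → B5.Local114Fam fam → B5.Prop12Printed fam`

for every instance of a family, from located leaves only, by the same kernel arithmetic as the (1.133) transfer
of `B5Transfer133` (whose data `Carrier133`, display `Display133`, row sums `URow` and index maps `mIdx`/`pIdx` are
REUSED with the roles outer operator := G₀, estimated operator := G):

* `Display133 K Dh` for `K : Carrier133 (famG0 i) (fam i)` — the identity (1.132) applied ENTRYWISE, in weak form:
  decomposing ∂P∂*G^{(p)}J = Σ_{y″∈T₁} 1_{Δ(y″)}∂P∂*G^{(p)}J into unit-cube pieces (p = 0: GJ; p = 2: G∇*J),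
  GJ = G₀J + Σ G₀(piece), ∇GJ = ∇G₀J + Σ ∇G₀(piece), ΔGJ = ΔG₀J + Σ ΔG₀(piece), G∇*J = G₀∇*J + Σ G₀(piece′),
  ∇G∇*J = ∇G₀∇*J + Σ ∇G₀(piece′); hence every sup / Hölder entry of Prop. 1.2 for G at (J, y) is ≤ the same entry
  for G₀ plus a sum over y″ of FIRST-ORDER entries of G₀ applied to the pieces (the Hölder quotient of ζ·G₀(piece′)
  by the product rule and the lattice mean-value inequality, constant `Dh`) — literally the fields of `Display133`;
* `MapFacts` — the model-evident compatibilities of the two abstract carriers of G₀ and G (same torus, cubes,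
  sources, cut-offs, norms (1.108)–(1.109)); `KerCarrier` / `PieceFacts132` — WHERE (1.126) AND (1.114) ENTER: the
  kernel carrier `B5.KernelData` of the leaf lives on the same η-lattice (membership of η-points in the unit cubes
  Δ(y″) and in the enlarged cubes Δ̃(w), with |y″ − w| − c₀ ≤ |x − x′| for x ∈ Δ(y″), x′ ∈ Δ̃(w)), and the sup norm
  of a piece is bounded by BLOCKWISE KERNEL MAJORANTS against the localized L² norms:
  |1_{Δ(y″)}∂P∂*g| ≤ A·Σ_{w∈T₁} M(w)‖ζ_w g‖ whenever |(∂P∂*)(x, x′)| ≤ M(w) (M ≥ 0) for x ∈ Δ(y″), x′ ∈ Δ̃(w)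
  (Cauchy–Schwarz on each unit block of η^d-measure O(1), ζ_w = 1 on Δ(w), |ζ_w| ≤ 1; A absorbs d and the vector
  indices μ, ν), g = GJ or G∇*J — i.e. exactly the localized L² norms of (1.114) for G (`B5.Local114Fam fam`, the
  output of the printed step S1′ «the proof of inequalities (1.114) … is completed because we have proved (1.89)»);
* `URow` — row sums of the unit lattice, for every rate, uniformly in the family.

KERNEL-CHECKED: (1.126) ⟹ the blockwise majorant M(w) = C e^{δ′₀c₀} e^{−δ′₀|y″−w|}; with (1.114) and the unit-lattice
convolution `B5Transfer133.conv_sum_le` this gives the PIECE DECAY |piece_{y″}| ≤ P e^{−½δ|y″−y′|}|J|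
(`pieceDecay_of_kernel`, δ = min(δ′₀, rate of (1.114))); then the four kinds of entries of Prop. 1.2 for G from those
of G₀ (`supEntry_of_pieces`, `h1Entry_of_pieces`, `e4Entry_of_pieces`, `h2Entry_of_pieces`, generic in the piece
decay), the family statements `firstOrder_of_pieces`, `secondOrder_of_pieces`, `pieceDecay_fam`, and the printed
sentence itself `prop12_of_G0_via132`; corollaries: `prop12_via132_of_printed_steps` (= `B5.prop12_of_printed_steps`
with the slots S2, S1 and the global Hölder data `g` REMOVED — Prop. 1.2 for G from h11, the leaf, S1′ and S3 only)
and `prop12_of_B4_via132` (the whole B4 → B5 chain: S3 supplied by `B5Transfer133.prop12G0_of_B4_via133`).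

WHAT REMAINS A NAMED HYPOTHESIS (located, not proved): `Display133` (our entrywise weak form of (1.132) with the
cube decomposition — the identity is printed, this use of it is the word «immediately»), `MapFacts`, `PieceFacts132`
(model-evident facts about the torus, its cubes, the norms, and one Cauchy–Schwarz inequality per block), `URow`;
upstream: Prop. 1.1 for G and for G₀, (1.114) for G from (1.89) (S1′) and for G₀ (h114G0) — the random-walk
expansions of Sect. E in L², printed mathematics not formalised here —, the leaf (1.126)–(1.127) (B4's METHOD, GAPS
C-B5-6), and everything listed in `B5Transfer133.prop12G0_of_B4_via133`.  Of the leaf only (1.126) is consumed by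
this pairing; (1.127) (Hölder continuity of the kernel) is needed by the paper's first pairing / step S1, not here.
The global bounds (1.115)–(1.117) (`B5.Global115_117Fam`) are NOT derived (they are the first pairing).  No operator
theory on the torus is formalised.  Nothing here is progress on any Millennium problem: it is bookkeeping that turns
the printed word «immediately» into kernel-checked arithmetic over located leaves.

Value = kernel arithmetic + located leaves, NOT summit progress.  Cell pub-balaban, unit `b2b-balaban-b05-g3`
(paper sub-cell B05, gen 3), fourth certificate (after `B5Ineq113`, `B5Ineq110Gp`, `B5Transfer133`); census ids
C-B5-22 / G-B5-22, divergence note D-b05g3.4.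
-/

namespace Literature.MathematicalPhysics.QuantumFieldTheory.Balaban1983to89.B5Transfer132

open Finset B5FromB4 B5Transfer133

variable {S' S₀ : B5.Setting}

/-! ## §1. The located leaves of (1.132): carrier facts, the kernel carrier, blockwise majorants -/

/-- **Carrier facts (located leaf, model-evident).**  For a carrier `K : Carrier133 S' S₀` (outer operator `S'`,
here G₀ = (Δ + aQ*Q)^{−1}; estimated operator `S₀`, here G): compatibility of the site / source / cut-off maps with
distances, supports, cut-offs and the norms (1.108)–(1.109) (identities in the model); the unit-lattice triangle
inequality; neighbourhoods of radius `r0` with at most `Nn` points; the cube pieces 1_{Δ(y″)}∂P∂*G^{(p)}J are sources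
localized at y″.  (= the fields of `B5Transfer133.CarrierFacts` that do not concern the piece norms.)
[cite: Balaban1984PropagatorsI, (1.132) p.39, (1.108)–(1.109) p.35] -/
structure MapFacts (K : Carrier133 S' S₀) (r0 Nn : ℝ) : Prop where
  dist_le : ∀ y y' : S₀.Site, S₀.dist y y' ≤ S'.dist (K.σ y) (K.σ y')
  tri : ∀ y y'' y' : S₀.Site, S₀.dist y y' ≤ S₀.dist y y'' + S₀.dist y'' y'
  supp_map : ∀ (J : S₀.Loc) (y' : S₀.Site), S₀.suppIn J y' → S'.suppIn (K.ι J) (K.σ y')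
  cut_map : ∀ (ζ : S₀.Cut) (y : S₀.Site), S₀.cutIn ζ y → S'.cutIn (K.κ ζ) (K.σ y)
  supNorm_map : ∀ J : S₀.Loc, S'.supNorm (K.ι J) ≤ S₀.supNorm J
  holder_map : ∀ (ε : ℝ) (J : S₀.Loc), S'.holder ε (K.ι J) ≤ S₀.holder ε J
  cutH_map : ∀ (α : ℝ) (ζ : S₀.Cut), S'.cutH α (K.κ ζ) ≤ S₀.cutH α ζ
  nbr_dist : ∀ y w : S₀.Site, w ∈ K.nbr y → S₀.dist y w ≤ r0
  nbr_card : ∀ y : S₀.Site, ((K.nbr y).card : ℝ) ≤ Nn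
  r0_nonneg : 0 ≤ r0
  Nn_nonneg : 0 ≤ Nn
  piece_supp : ∀ (p : Fin 6) (J : S₀.Loc) (y'' : S₀.Site), y'' ∈ K.T1 → S'.suppIn (K.piece p J y'') (K.σ y'')

/-- **Kernel carrier (data).**  The η-lattice `Kd.X` of the kernel leaf (1.126)–(1.127) is the lattice T_η on which
G, G₀ act: `inCube x y″` = "x ∈ Δ(y″)" (the unit cube of the unit-lattice point y″), `inDCube x′ w` = "x′ ∈ Δ̃(w)"
(the enlarged cube, ⊇ supp ζ_w). [cite: Balaban1984PropagatorsI, (1.126) p.38, (1.132) p.39] -/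
structure KerCarrier (Kd : B5.KernelData) (S₀ : B5.Setting) where
  inCube : Kd.X → S₀.Site → Prop
  inDCube : Kd.X → S₀.Site → Prop

/-- **Piece facts (located leaf): where (1.126) and (1.114) enter.**  `ζ0 w` = a cut-off equal to 1 on Δ(w),
supported in Δ̃(w), |ζ0 w| ≤ 1; ‖J‖ ≤ B|J| for supp J ⊂ Δ̃(y′); the cube geometry |y″ − w| − c₀ ≤ |x − x′| for
x ∈ Δ(y″), x′ ∈ Δ̃(w); and `piece_norm`: if M(w) ≥ 0 majorizes |(∂P∂*)_{μν}(x, x′)| for x ∈ Δ(y″), x′ ∈ Δ̃(w), then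
|1_{Δ(y″)}∂P∂*G^{(p)}J| ≤ A·Σ_{w∈T₁} M(w)·‖ζ0_w G^{(p)}J‖ — splitting the x′-sum over the unit blocks and
Cauchy–Schwarz on each block (η^d-measure O(1)); A = A(d) absorbs the block measure and the indices μ, ν.  True in
the model also in the degenerate cases (an empty block contributes nothing).  Not printed; located: OUR READING of
«This together with the properties (1.126), (1.127) of ∂P∂* and … (1.114) for the operator G implies immediately».
[cite: Balaban1984PropagatorsI, (1.132) p.39, (1.126) p.38, (1.114) p.36] -/
structure PieceFacts132 {Kd : B5.KernelData} (K : Carrier133 S' S₀) (Kc : KerCarrier Kd S₀) (A B c₀ : ℝ) :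
    Prop where
  ζ0_in : ∀ y : S₀.Site, S₀.cutIn (K.ζ0 y) y
  ζ0_sup : ∀ y : S₀.Site, S₀.cutSup (K.ζ0 y) ≤ 1
  l2_le_sup : ∀ (J : S₀.Loc) (y' : S₀.Site), S₀.suppIn J y' → S₀.l2Norm J ≤ B * S₀.supNorm J
  B_nonneg : 0 ≤ B
  A_nonneg : 0 ≤ A
  dist_ge : ∀ (y'' w : S₀.Site) (x x' : Kd.X), Kc.inCube x y'' → Kc.inDCube x' w →
    S₀.dist y'' w - c₀ ≤ Kd.dist x x'
  piece_norm : ∀ (p : Fin 6) (J : S₀.Loc) (y'' : S₀.Site) (M : S₀.Site → ℝ), y'' ∈ K.T1 → (∀ w, 0 ≤ M w) →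
    (∀ (w : S₀.Site) (x x' : Kd.X), Kc.inCube x y'' → Kc.inDCube x' w → |Kd.ker x x'| ≤ M w) →
    S'.supNorm (K.piece p J y'') ≤ A * ∑ w ∈ K.T1, M w * S₀.l2loc p J (K.ζ0 w)

/-- **Piece decay** with constant P and rate δp: |1_{Δ(y″)}∂P∂*G^{(p)}J| ≤ P e^{−δp|y″−y′|}|J| for supp J ⊂ Δ̃(y′)
(the only property of the pieces the transfer uses). [cite: Balaban1984PropagatorsI, (1.132) p.39] -/
def PieceDecay (K : Carrier133 S' S₀) (P δp : ℝ) : Prop :=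
  ∀ (p : Fin 6) (J : S₀.Loc) (y' y'' : S₀.Site), S₀.suppIn J y' → y'' ∈ K.T1 →
    S'.supNorm (K.piece p J y'') ≤ P * Real.exp (-(δp * S₀.dist y'' y')) * S₀.supNorm J

/-- (1.126) for one instance: |(∂P∂*)_{μν}(x, x′)| ≤ C e^{−δ′₀|x−x′|} (literally the first conjunct of the leaf
`B5.Kernel126_127Printed` at the instance). [cite: Balaban1984PropagatorsI, (1.126) p.38] -/
def KerBound (Kd : B5.KernelData) (C δ₀' : ℝ) : Prop :=
  ∀ x x' : Kd.X, |Kd.ker x x'| ≤ C * Real.exp (-(δ₀' * Kd.dist x x'))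


/-! ## §2. One instance: the piece decay from (1.126) and (1.114); the four kinds of entries -/

section Instance

variable (K : Carrier133 S' S₀) {r0 Nn Dh P δp : ℝ}

/-- **Piece decay from (1.126) and (1.114).**  The blockwise majorant M(w) = C e^{δ′₀c₀} e^{−δ′₀|y″−w|} from (1.126)
and the cube geometry; each block term ≤ M(w)·C₂e^{−δ₂|w−y′|}·B|J| by (1.114) (entry p, constant C₂, rate δ₂),
|ζ0_w| ≤ 1 and ‖J‖ ≤ B|J|; the unit-lattice convolution Σ_w e^{−δ′₀|y″−w|}e^{−δ₂|w−y′|} ≤ Λ e^{−½δ|y″−y′|}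
(δ ≤ δ′₀, δ₂; Λ the ½δ row sum).  Result: piece decay with P = A·C e^{δ′₀c₀}·C₂·B·Λ and rate ½δ.
[cite: Balaban1984PropagatorsI, (1.132) p.39, (1.126) p.38, (1.114) p.36] -/
theorem pieceDecay_of_kernel {Kd : B5.KernelData} {Kc : KerCarrier Kd S₀} {A B c₀ : ℝ} (Mf : MapFacts K r0 Nn)
    (Pf : PieceFacts132 K Kc A B c₀) (Sg₀ : ModelSigns S₀) {C δ₀' C₂ δ₂ δ Λ : ℝ} (hC : 0 ≤ C) (hC₂ : 0 ≤ C₂)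
    (hδ : 0 ≤ δ) (h1 : δ ≤ δ₀') (h2 : δ ≤ δ₂) (hK : KerBound Kd C δ₀') (Hl2 : ∀ p, L2Entry S₀ p C₂ δ₂)
    (row : URow K (δ / 2) Λ) :
    PieceDecay K (A * (C * Real.exp (δ₀' * c₀)) * C₂ * B * Λ) (δ / 2) := by
  intro p J y' y'' hs hy''
  have hδ₀' : 0 ≤ δ₀' := hδ.trans h1
  have hJ0 : 0 ≤ S₀.supNorm J := Sg₀.supNorm_nonneg J
  have hB0 : 0 ≤ B := Pf.B_nonneg
  -- the blockwise kernel majorant from (1.126) and the cube geometry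
  have hM0 : ∀ w : S₀.Site, 0 ≤ C * Real.exp (δ₀' * c₀) * Real.exp (-(δ₀' * S₀.dist y'' w)) :=
    fun w => by positivity
  have hMaj : ∀ (w : S₀.Site) (x x' : Kd.X), Kc.inCube x y'' → Kc.inDCube x' w →
      |Kd.ker x x'| ≤ C * Real.exp (δ₀' * c₀) * Real.exp (-(δ₀' * S₀.dist y'' w)) := by
    intro w x x' hx hx'
    calc |Kd.ker x x'| ≤ C * Real.exp (-(δ₀' * Kd.dist x x')) := hK x x'
      _ ≤ C * (Real.exp (δ₀' * c₀) * Real.exp (-(δ₀' * S₀.dist y'' w))) :=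
          mul_le_mul_of_nonneg_left (exp_shift hδ₀' (Pf.dist_ge y'' w x x' hx hx')) hC
      _ = _ := by ring
  have hpn := Pf.piece_norm p J y'' (fun w => C * Real.exp (δ₀' * c₀) * Real.exp (-(δ₀' * S₀.dist y'' w)))
    hy'' hM0 hMaj
  -- each block term, by (1.114)
  have hterm : ∀ w ∈ K.T1,
      C * Real.exp (δ₀' * c₀) * Real.exp (-(δ₀' * S₀.dist y'' w)) * S₀.l2loc p J (K.ζ0 w) ≤
        C * Real.exp (δ₀' * c₀) * C₂ * B * S₀.supNorm J *
          (Real.exp (-(δ₀' * S₀.dist y'' w)) * Real.exp (-(δ₂ * S₀.dist w y'))) := by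
    intro w _
    have hl := Hl2 p J (K.ζ0 w) w y' (Pf.ζ0_in w) hs
    have hl' : C₂ * Real.exp (-(δ₂ * S₀.dist w y')) * S₀.cutSup (K.ζ0 w) * S₀.l2Norm J ≤
        C₂ * Real.exp (-(δ₂ * S₀.dist w y')) * 1 * (B * S₀.supNorm J) :=
      mul_le_mul (mul_le_mul_of_nonneg_left (Pf.ζ0_sup w) (mul_nonneg hC₂ (Real.exp_nonneg _)))
        (Pf.l2_le_sup J y' hs) (Sg₀.l2Norm_nonneg J) (by positivity)
    calc C * Real.exp (δ₀' * c₀) * Real.exp (-(δ₀' * S₀.dist y'' w)) * S₀.l2loc p J (K.ζ0 w)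
        ≤ C * Real.exp (δ₀' * c₀) * Real.exp (-(δ₀' * S₀.dist y'' w)) *
            (C₂ * Real.exp (-(δ₂ * S₀.dist w y')) * 1 * (B * S₀.supNorm J)) :=
          mul_le_mul_of_nonneg_left (hl.trans hl') (hM0 w)
      _ = _ := by ring
  have hconv :=
    conv_sum_le K.T1 S₀.dist y'' y' hδ h1 h2 Sg₀.dist_nonneg (fun w => Mf.tri y'' w y') (row y'')
  have hc0 : 0 ≤ C * Real.exp (δ₀' * c₀) * C₂ * B * S₀.supNorm J := by positivity
  calc S'.supNorm (K.piece p J y'')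
      ≤ A * ∑ w ∈ K.T1, C * Real.exp (δ₀' * c₀) * Real.exp (-(δ₀' * S₀.dist y'' w)) *
          S₀.l2loc p J (K.ζ0 w) := hpn
    _ ≤ A * ∑ w ∈ K.T1, C * Real.exp (δ₀' * c₀) * C₂ * B * S₀.supNorm J *
          (Real.exp (-(δ₀' * S₀.dist y'' w)) * Real.exp (-(δ₂ * S₀.dist w y'))) :=
        mul_le_mul_of_nonneg_left (Finset.sum_le_sum hterm) Pf.A_nonneg
    _ = A * (C * Real.exp (δ₀' * c₀) * C₂ * B * S₀.supNorm J *
          ∑ w ∈ K.T1, Real.exp (-(δ₀' * S₀.dist y'' w)) * Real.exp (-(δ₂ * S₀.dist w y'))) := by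
        congr 1; rw [Finset.mul_sum]
    _ ≤ A * (C * Real.exp (δ₀' * c₀) * C₂ * B * S₀.supNorm J * (Λ * Real.exp (-(δ / 2 * S₀.dist y'' y')))) :=
        mul_le_mul_of_nonneg_left (mul_le_mul_of_nonneg_left hconv hc0) Pf.A_nonneg
    _ = _ := by ring

/-- Piece decay is monotone in the constant (|J| ≥ 0). [folklore] -/
theorem pieceDecay_mono (Sg₀ : ModelSigns S₀) {P' : ℝ} (h : PieceDecay K P δp) (hP : P ≤ P') :
    PieceDecay K P' δp :=
  fun p J y' y'' hs hy'' => (h p J y' y'' hs hy'').trans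
    (mul_le_mul_of_nonneg_right (mul_le_mul_of_nonneg_right hP (Real.exp_nonneg _)) (Sg₀.supNorm_nonneg J))

/-- A first-order sup entry of the outer operator (`S'`; here G₀) with constant C₁ and rate δ₁, applied to a cube
piece and evaluated over Δ̃(z) for a unit point z with |y − y″| − r ≤ |z − y″| (z = y with r = 0, or z adjacent to
y with r = r0): ≤ C₁e^{δ₁r}e^{−δ₁|y−y″|}·P e^{−δp|y″−y′|}|J|, P and δp being the constant and rate of the piece decay.
[cite: Balaban1984PropagatorsI, (1.132) p.39, (1.110) p.35] -/
theorem sup_piece_decay (Mf : MapFacts K r0 Nn) (hPD : PieceDecay K P δp) (Sg' : ModelSigns S')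
    {C₁ δ₁ : ℝ} (hC₁ : 0 ≤ C₁) (hδ₁ : 0 ≤ δ₁) (m : Fin 4) (p : Fin 6)
    (He : SupEntry S' m C₁ δ₁) (J : S₀.Loc) (y y' y'' z : S₀.Site) (r : ℝ)
    (hs : S₀.suppIn J y') (hy'' : y'' ∈ K.T1) (hz : S₀.dist y y'' - r ≤ S₀.dist z y'') :
    S'.e m (K.piece p J y'') (K.σ z) ≤
      C₁ * Real.exp (δ₁ * r) * Real.exp (-(δ₁ * S₀.dist y y'')) *
        (P * Real.exp (-(δp * S₀.dist y'' y')) * S₀.supNorm J) := by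
  have h0 := He (K.piece p J y'') (K.σ z) (K.σ y'') (Mf.piece_supp p J y'' hy'')
  have hD : Real.exp (-(δ₁ * S'.dist (K.σ z) (K.σ y''))) ≤ Real.exp (-(δ₁ * S₀.dist z y'')) :=
    Real.exp_le_exp.mpr (neg_le_neg (mul_le_mul_of_nonneg_left (Mf.dist_le z y'') hδ₁))
  have hD' : Real.exp (-(δ₁ * S₀.dist z y'')) ≤ Real.exp (δ₁ * r) * Real.exp (-(δ₁ * S₀.dist y y'')) :=
    exp_shift hδ₁ hz
  have hP := hPD p J y' y'' hs hy''
  calc S'.e m (K.piece p J y'') (K.σ z)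
      ≤ C₁ * Real.exp (-(δ₁ * S'.dist (K.σ z) (K.σ y''))) * S'.supNorm (K.piece p J y'') := h0
    _ ≤ C₁ * (Real.exp (δ₁ * r) * Real.exp (-(δ₁ * S₀.dist y y''))) *
          (P * Real.exp (-(δp * S₀.dist y'' y')) * S₀.supNorm J) :=
        mono3 hC₁ (hD.trans hD') (Real.exp_nonneg _) hP (Sg'.supNorm_nonneg _)
    _ = _ := by ring

/-- The sum over the cube decomposition of a first-order entry of the outer operator applied to the pieces, at y
itself: Σ_{y″∈T₁} ≤ C₁·P·Λ·e^{−½δ|y−y′|}|J| with δ ≤ δ₁, δp and Λ the ½δ row sum.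
[cite: Balaban1984PropagatorsI, (1.132) p.39] -/
theorem sum_sup_piece_decay (Mf : MapFacts K r0 Nn) (hPD : PieceDecay K P δp) (hP0 : 0 ≤ P)
    (Sg' : ModelSigns S') (Sg₀ : ModelSigns S₀) {C₁ δ₁ δ Λ : ℝ} (hC₁ : 0 ≤ C₁) (hδ : 0 ≤ δ) (h1 : δ ≤ δ₁)
    (h2 : δ ≤ δp) (m : Fin 4) (p : Fin 6) (He : SupEntry S' m C₁ δ₁) (row : URow K (δ / 2) Λ)
    (J : S₀.Loc) (y y' : S₀.Site) (hs : S₀.suppIn J y') :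
    ∑ y'' ∈ K.T1, S'.e m (K.piece p J y'') (K.σ y) ≤
      C₁ * P * Λ * Real.exp (-(δ / 2 * S₀.dist y y')) * S₀.supNorm J := by
  have hδ₁ : 0 ≤ δ₁ := hδ.trans h1
  have hterm : ∀ y'' ∈ K.T1, S'.e m (K.piece p J y'') (K.σ y) ≤
      C₁ * P * S₀.supNorm J *
        (Real.exp (-(δ₁ * S₀.dist y y'')) * Real.exp (-(δp * S₀.dist y'' y'))) := by
    intro y'' hy''
    have h := sup_piece_decay K Mf hPD Sg' hC₁ hδ₁ m p He J y y' y'' y 0 hs hy'' (by linarith)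
    rw [mul_zero, Real.exp_zero, mul_one] at h
    refine h.trans (le_of_eq ?_)
    ring
  have hconv := conv_sum_le K.T1 S₀.dist y y' hδ h1 h2 Sg₀.dist_nonneg (fun y'' => Mf.tri y y'' y') (row y)
  have hc0 : 0 ≤ C₁ * P * S₀.supNorm J := by
    have := Sg₀.supNorm_nonneg J; positivity
  calc ∑ y'' ∈ K.T1, S'.e m (K.piece p J y'') (K.σ y)
      ≤ ∑ y'' ∈ K.T1, C₁ * P * S₀.supNorm J *
          (Real.exp (-(δ₁ * S₀.dist y y'')) * Real.exp (-(δp * S₀.dist y'' y'))) := Finset.sum_le_sum hterm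
    _ = C₁ * P * S₀.supNorm J *
          ∑ y'' ∈ K.T1, Real.exp (-(δ₁ * S₀.dist y y'')) * Real.exp (-(δp * S₀.dist y'' y')) := by
        rw [Finset.mul_sum]
    _ ≤ C₁ * P * S₀.supNorm J *
          (Λ * Real.exp (-(δ / 2 * S₀.dist y y'))) := mul_le_mul_of_nonneg_left hconv hc0
    _ = _ := by ring

/-- The neighbourhood version for the Hölder entry of ζG₀(piece′) (outer operator G₀ = `S'`):
Σ_{y″∈T₁} Σ_{w ∈ nbr y} (|G₀(piece′)| + |∇G₀(piece′)|) over Δ̃(w) ≤ 2·Nn·C₁e^{δ₁r0}·P·Λ·e^{−½δ|y−y′|}|J|.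
[cite: Balaban1984PropagatorsI, (1.132) p.39] -/
theorem sum_nbr_piece_decay (Mf : MapFacts K r0 Nn) (hPD : PieceDecay K P δp) (hP0 : 0 ≤ P)
    (Sg' : ModelSigns S') (Sg₀ : ModelSigns S₀) {C₁ δ₁ δ Λ : ℝ} (hC₁ : 0 ≤ C₁) (hδ : 0 ≤ δ) (h1 : δ ≤ δ₁)
    (h2 : δ ≤ δp) (He0 : SupEntry S' 0 C₁ δ₁) (He1 : SupEntry S' 1 C₁ δ₁) (row : URow K (δ / 2) Λ)
    (J : S₀.Loc) (y y' : S₀.Site) (hs : S₀.suppIn J y') :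
    ∑ y'' ∈ K.T1, ∑ w ∈ K.nbr y, (S'.e 0 (K.piece 2 J y'') (K.σ w) + S'.e 1 (K.piece 2 J y'') (K.σ w)) ≤
      2 * Nn * (C₁ * Real.exp (δ₁ * r0)) * P * Λ *
        Real.exp (-(δ / 2 * S₀.dist y y')) * S₀.supNorm J := by
  have hδ₁ : 0 ≤ δ₁ := hδ.trans h1
  have hJ0 := Sg₀.supNorm_nonneg J
  -- each inner term
  have hinner : ∀ y'' ∈ K.T1, ∀ w ∈ K.nbr y,
      S'.e 0 (K.piece 2 J y'') (K.σ w) + S'.e 1 (K.piece 2 J y'') (K.σ w) ≤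
        2 * (C₁ * Real.exp (δ₁ * r0)) * P * S₀.supNorm J *
          (Real.exp (-(δ₁ * S₀.dist y y'')) * Real.exp (-(δp * S₀.dist y'' y'))) := by
    intro y'' hy'' w hw
    have hz : S₀.dist y y'' - r0 ≤ S₀.dist w y'' := by
      have t1 := Mf.tri y w y''
      have t2 := Mf.nbr_dist y w hw
      linarith
    have a0 := sup_piece_decay K Mf hPD Sg' hC₁ hδ₁ 0 2 He0 J y y' y'' w r0 hs hy'' hz
    have a1 := sup_piece_decay K Mf hPD Sg' hC₁ hδ₁ 1 2 He1 J y y' y'' w r0 hs hy'' hz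
    have := add_le_add a0 a1
    refine this.trans (le_of_eq ?_)
    ring
  have hmid : ∀ y'' ∈ K.T1,
      ∑ w ∈ K.nbr y, (S'.e 0 (K.piece 2 J y'') (K.σ w) + S'.e 1 (K.piece 2 J y'') (K.σ w)) ≤
        Nn * (2 * (C₁ * Real.exp (δ₁ * r0)) * P * S₀.supNorm J *
          (Real.exp (-(δ₁ * S₀.dist y y'')) * Real.exp (-(δp * S₀.dist y'' y')))) := by
    intro y'' hy''
    have hb0 : 0 ≤ 2 * (C₁ * Real.exp (δ₁ * r0)) * P * S₀.supNorm J *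
        (Real.exp (-(δ₁ * S₀.dist y y'')) * Real.exp (-(δp * S₀.dist y'' y'))) := by positivity
    calc ∑ w ∈ K.nbr y, (S'.e 0 (K.piece 2 J y'') (K.σ w) + S'.e 1 (K.piece 2 J y'') (K.σ w))
        ≤ ∑ w ∈ K.nbr y, 2 * (C₁ * Real.exp (δ₁ * r0)) * P * S₀.supNorm J *
            (Real.exp (-(δ₁ * S₀.dist y y'')) * Real.exp (-(δp * S₀.dist y'' y'))) :=
          Finset.sum_le_sum (hinner y'' hy'')
      _ = (K.nbr y).card * (2 * (C₁ * Real.exp (δ₁ * r0)) * P * S₀.supNorm J *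
            (Real.exp (-(δ₁ * S₀.dist y y'')) * Real.exp (-(δp * S₀.dist y'' y')))) := by
          rw [Finset.sum_const, nsmul_eq_mul]
      _ ≤ _ := mul_le_mul_of_nonneg_right (Mf.nbr_card y) hb0
  have hconv := conv_sum_le K.T1 S₀.dist y y' hδ h1 h2 Sg₀.dist_nonneg (fun y'' => Mf.tri y y'' y') (row y)
  have hc0 : 0 ≤ Nn * (2 * (C₁ * Real.exp (δ₁ * r0)) * P * S₀.supNorm J) := by
    have := Mf.Nn_nonneg; positivity
  calc ∑ y'' ∈ K.T1, ∑ w ∈ K.nbr y, (S'.e 0 (K.piece 2 J y'') (K.σ w) + S'.e 1 (K.piece 2 J y'') (K.σ w))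
      ≤ ∑ y'' ∈ K.T1, Nn * (2 * (C₁ * Real.exp (δ₁ * r0)) * P * S₀.supNorm J *
          (Real.exp (-(δ₁ * S₀.dist y y'')) * Real.exp (-(δp * S₀.dist y'' y')))) := Finset.sum_le_sum hmid
    _ = Nn * (2 * (C₁ * Real.exp (δ₁ * r0)) * P * S₀.supNorm J) *
          ∑ y'' ∈ K.T1, Real.exp (-(δ₁ * S₀.dist y y'')) * Real.exp (-(δp * S₀.dist y'' y')) := by
        rw [Finset.mul_sum]; refine Finset.sum_congr rfl fun y'' _ => ?_; ring
    _ ≤ Nn * (2 * (C₁ * Real.exp (δ₁ * r0)) * P * S₀.supNorm J) *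
          (Λ * Real.exp (-(δ / 2 * S₀.dist y y'))) := mul_le_mul_of_nonneg_left hconv hc0
    _ = _ := by ring

/-- The sum over the cube decomposition of the max-Hölder entry (1.111) of the outer operator (constant Cα(α), rate
δ₁) applied to the pieces: Σ_{y″∈T₁} ≤ max(Cα(α),0)·P·Λ·e^{−½δ|y−y′|}(‖ζ‖_α + |ζ|)|J|.
[cite: Balaban1984PropagatorsI, (1.132) p.39, (1.111) p.35] -/
theorem sum_h1_piece_decay (Mf : MapFacts K r0 Nn) (hPD : PieceDecay K P δp) (hP0 : 0 ≤ P)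
    (Sg' : ModelSigns S') (Sg₀ : ModelSigns S₀) {Cα : ℝ → ℝ} {δ₁ δ Λ : ℝ} (hδ : 0 ≤ δ) (h1 : δ ≤ δ₁)
    (h2 : δ ≤ δp) (p : Fin 6) (Hh1 : H1Entry S' Cα δ₁) (row : URow K (δ / 2) Λ)
    (α : ℝ) (J : S₀.Loc) (ζ : S₀.Cut) (y y' : S₀.Site) (hα0 : 0 ≤ α) (hα1 : α < 1) (hζ : S₀.cutIn ζ y)
    (hs : S₀.suppIn J y') :
    ∑ y'' ∈ K.T1, S'.h1 (K.piece p J y'') α (K.κ ζ) ≤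
      max (Cα α) 0 * P * Λ * Real.exp (-(δ / 2 * S₀.dist y y')) *
        S₀.cutH α ζ * S₀.supNorm J := by
  have hδ₁ : 0 ≤ δ₁ := hδ.trans h1
  have hJ0 := Sg₀.supNorm_nonneg J
  have hH0 := Sg₀.cutH_nonneg α ζ
  have hCa0 : 0 ≤ max (Cα α) 0 := le_max_right _ _
  have hterm : ∀ y'' ∈ K.T1, S'.h1 (K.piece p J y'') α (K.κ ζ) ≤
      max (Cα α) 0 * P * S₀.cutH α ζ * S₀.supNorm J *
        (Real.exp (-(δ₁ * S₀.dist y y'')) * Real.exp (-(δp * S₀.dist y'' y'))) := by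
    intro y'' hy''
    have h0 := Hh1 α (K.piece p J y'') (K.κ ζ) (K.σ y) (K.σ y'') hα0 hα1 (Mf.cut_map ζ y hζ)
      (Mf.piece_supp p J y'' hy'')
    -- replace Cα by max (Cα) 0, the S'-distance by the S₀-distance, the S'-cutH by the S₀ one, the piece norm
    have hD : Real.exp (-(δ₁ * S'.dist (K.σ y) (K.σ y''))) ≤ Real.exp (-(δ₁ * S₀.dist y y'')) :=
      Real.exp_le_exp.mpr (neg_le_neg (mul_le_mul_of_nonneg_left (Mf.dist_le y y'') hδ₁))
    have hPc := hPD p J y' y'' hs hy''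
    have step1 : Cα α * Real.exp (-(δ₁ * S'.dist (K.σ y) (K.σ y''))) * S'.cutH α (K.κ ζ) *
        S'.supNorm (K.piece p J y'') ≤ max (Cα α) 0 * Real.exp (-(δ₁ * S'.dist (K.σ y) (K.σ y''))) *
        S'.cutH α (K.κ ζ) * S'.supNorm (K.piece p J y'') :=
      mul_le_mul_of_nonneg_right (mul_le_mul_of_nonneg_right (mul_le_mul_of_nonneg_right (le_max_left _ _)
        (Real.exp_nonneg _)) (Sg'.cutH_nonneg _ _)) (Sg'.supNorm_nonneg _)
    have step2 : max (Cα α) 0 * Real.exp (-(δ₁ * S'.dist (K.σ y) (K.σ y''))) * S'.cutH α (K.κ ζ) *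
        S'.supNorm (K.piece p J y'') ≤ max (Cα α) 0 * Real.exp (-(δ₁ * S₀.dist y y'')) * S₀.cutH α ζ *
        (P * Real.exp (-(δp * S₀.dist y'' y')) * S₀.supNorm J) :=
      mono4 hCa0 hD (Real.exp_nonneg _) (Mf.cutH_map α ζ) (Sg'.cutH_nonneg _ _) hPc (Sg'.supNorm_nonneg _)
    refine (h0.trans (step1.trans step2)).trans (le_of_eq ?_)
    ring
  have hconv := conv_sum_le K.T1 S₀.dist y y' hδ h1 h2 Sg₀.dist_nonneg (fun y'' => Mf.tri y y'' y') (row y)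
  have hc0 : 0 ≤ max (Cα α) 0 * P * S₀.cutH α ζ * S₀.supNorm J := by positivity
  calc ∑ y'' ∈ K.T1, S'.h1 (K.piece p J y'') α (K.κ ζ)
      ≤ ∑ y'' ∈ K.T1, max (Cα α) 0 * P * S₀.cutH α ζ * S₀.supNorm J *
          (Real.exp (-(δ₁ * S₀.dist y y'')) * Real.exp (-(δp * S₀.dist y'' y'))) := Finset.sum_le_sum hterm
    _ = max (Cα α) 0 * P * S₀.cutH α ζ * S₀.supNorm J *
          ∑ y'' ∈ K.T1, Real.exp (-(δ₁ * S₀.dist y y'')) * Real.exp (-(δp * S₀.dist y'' y')) := by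
        rw [Finset.mul_sum]
    _ ≤ max (Cα α) 0 * P * S₀.cutH α ζ * S₀.supNorm J * (Λ * Real.exp (-(δ / 2 * S₀.dist y y'))) :=
        mul_le_mul_of_nonneg_left hconv hc0
    _ = _ := by ring

/-- **(1.110) for G from (1.110) for G₀ and the piece decay**, one instance, sup entry n, with explicit constant
C₁ + C₁·P·Λ and rate ½δ (δ ≤ the rate δ₁ of G₀ and the piece rate δp, Λ = the ½δ row sum).
[cite: Balaban1984PropagatorsI, (1.132) p.39, (1.110) p.35] -/
theorem supEntry_of_pieces (Mf : MapFacts K r0 Nn) (hPD : PieceDecay K P δp) (hP0 : 0 ≤ P)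
    (Dp : Display133 K Dh) (Sg' : ModelSigns S') (Sg₀ : ModelSigns S₀) {C₁ δ₁ δ Λ : ℝ} (hC₁ : 0 ≤ C₁)
    (hδ : 0 ≤ δ) (h1 : δ ≤ δ₁) (h2 : δ ≤ δp) (He : ∀ n, SupEntry S' n C₁ δ₁) (row : URow K (δ / 2) Λ)
    (n : Fin 4) :
    SupEntry S₀ n (C₁ + C₁ * P * Λ) (δ / 2) := by
  intro J y y' hs
  have hmain := He n (K.ι J) (K.σ y) (K.σ y') (Mf.supp_map J y' hs)
  have hD : Real.exp (-(δ₁ * S'.dist (K.σ y) (K.σ y'))) ≤ Real.exp (-(δ / 2 * S₀.dist y y')) :=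
    decay_transfer hδ h1 (Sg₀.dist_nonneg y y') (Mf.dist_le y y')
  have h1' : C₁ * Real.exp (-(δ₁ * S'.dist (K.σ y) (K.σ y'))) * S'.supNorm (K.ι J) ≤
      C₁ * Real.exp (-(δ / 2 * S₀.dist y y')) * S₀.supNorm J :=
    mono3 hC₁ hD (Real.exp_nonneg _) (Mf.supNorm_map J) (Sg'.supNorm_nonneg _)
  have hsum := sum_sup_piece_decay K Mf hPD hP0 Sg' Sg₀ hC₁ hδ h1 h2 (mIdx n) (pIdx n) (He _) row J y y' hs
  calc S₀.e n J y ≤ _ := Dp.sup n J y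
    _ ≤ C₁ * Real.exp (-(δ / 2 * S₀.dist y y')) * S₀.supNorm J +
        C₁ * P * Λ * Real.exp (-(δ / 2 * S₀.dist y y')) * S₀.supNorm J :=
        add_le_add (hmain.trans h1') hsum
    _ = _ := by ring

/-- **(1.111) for G from (1.110)–(1.111) for G₀ and the piece decay**, one instance, with explicit constant
α ↦ Cα⁺ + Cα⁺·P·Λ + Dh·(2·Nn·C₁e^{δ₁r0}·P·Λ) (Cα⁺ = max(Cα(α),0)) and rate ½δ.
[cite: Balaban1984PropagatorsI, (1.132) p.39, (1.111) p.35] -/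
theorem h1Entry_of_pieces (Mf : MapFacts K r0 Nn) (hPD : PieceDecay K P δp) (hP0 : 0 ≤ P)
    (Dp : Display133 K Dh) (Sg' : ModelSigns S') (Sg₀ : ModelSigns S₀) {Cα : ℝ → ℝ} {C₁ δ₁ δ Λ : ℝ}
    (hC₁ : 0 ≤ C₁) (hδ : 0 ≤ δ) (h1 : δ ≤ δ₁) (h2 : δ ≤ δp) (He : ∀ n, SupEntry S' n C₁ δ₁)
    (Hh1 : H1Entry S' Cα δ₁) (row : URow K (δ / 2) Λ) :
    H1Entry S₀ (fun α => max (Cα α) 0 + max (Cα α) 0 * P * Λ +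
      Dh * (2 * Nn * (C₁ * Real.exp (δ₁ * r0)) * P * Λ)) (δ / 2) := by
  intro α J ζ y y' hα0 hα1 hζ hs
  have hCa0 : 0 ≤ max (Cα α) 0 := le_max_right _ _
  have hmain := Hh1 α (K.ι J) (K.κ ζ) (K.σ y) (K.σ y') hα0 hα1 (Mf.cut_map ζ y hζ) (Mf.supp_map J y' hs)
  have hD : Real.exp (-(δ₁ * S'.dist (K.σ y) (K.σ y'))) ≤ Real.exp (-(δ / 2 * S₀.dist y y')) :=
    decay_transfer hδ h1 (Sg₀.dist_nonneg y y') (Mf.dist_le y y')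
  have step1 : Cα α * Real.exp (-(δ₁ * S'.dist (K.σ y) (K.σ y'))) * S'.cutH α (K.κ ζ) * S'.supNorm (K.ι J) ≤
      max (Cα α) 0 * Real.exp (-(δ₁ * S'.dist (K.σ y) (K.σ y'))) * S'.cutH α (K.κ ζ) * S'.supNorm (K.ι J) :=
    mul_le_mul_of_nonneg_right (mul_le_mul_of_nonneg_right (mul_le_mul_of_nonneg_right (le_max_left _ _)
      (Real.exp_nonneg _)) (Sg'.cutH_nonneg _ _)) (Sg'.supNorm_nonneg _)
  have step2 : max (Cα α) 0 * Real.exp (-(δ₁ * S'.dist (K.σ y) (K.σ y'))) * S'.cutH α (K.κ ζ) *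
      S'.supNorm (K.ι J) ≤ max (Cα α) 0 * Real.exp (-(δ / 2 * S₀.dist y y')) * S₀.cutH α ζ * S₀.supNorm J :=
    mono4 hCa0 hD (Real.exp_nonneg _) (Mf.cutH_map α ζ) (Sg'.cutH_nonneg _ _) (Mf.supNorm_map J)
      (Sg'.supNorm_nonneg _)
  have hA := sum_h1_piece_decay K Mf hPD hP0 Sg' Sg₀ hδ h1 h2 0 Hh1 row α J ζ y y' hα0 hα1 hζ hs
  have hB := sum_nbr_piece_decay K Mf hPD hP0 Sg' Sg₀ hC₁ hδ h1 h2 (He 0) (He 1) row J y y' hs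
  have hB' : Dh * S₀.cutH α ζ *
      ∑ y'' ∈ K.T1, ∑ w ∈ K.nbr y, (S'.e 0 (K.piece 2 J y'') (K.σ w) + S'.e 1 (K.piece 2 J y'') (K.σ w)) ≤
      Dh * S₀.cutH α ζ * (2 * Nn * (C₁ * Real.exp (δ₁ * r0)) * P * Λ *
        Real.exp (-(δ / 2 * S₀.dist y y')) * S₀.supNorm J) :=
    mul_le_mul_of_nonneg_left hB (mul_nonneg Dp.Dh_nonneg (Sg₀.cutH_nonneg α ζ))
  have hsplit : ∑ y'' ∈ K.T1, (S'.h1 (K.piece 0 J y'') α (K.κ ζ) + Dh * S₀.cutH α ζ *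
      ∑ w ∈ K.nbr y, (S'.e 0 (K.piece 2 J y'') (K.σ w) + S'.e 1 (K.piece 2 J y'') (K.σ w))) =
      ∑ y'' ∈ K.T1, S'.h1 (K.piece 0 J y'') α (K.κ ζ) + Dh * S₀.cutH α ζ *
        ∑ y'' ∈ K.T1, ∑ w ∈ K.nbr y, (S'.e 0 (K.piece 2 J y'') (K.σ w) + S'.e 1 (K.piece 2 J y'') (K.σ w)) := by
    rw [Finset.sum_add_distrib, Finset.mul_sum]
  calc S₀.h1 J α ζ ≤ _ := Dp.h1 J α ζ y hζ
    _ = S'.h1 (K.ι J) α (K.κ ζ) + (∑ y'' ∈ K.T1, S'.h1 (K.piece 0 J y'') α (K.κ ζ) + Dh * S₀.cutH α ζ *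
        ∑ y'' ∈ K.T1, ∑ w ∈ K.nbr y, (S'.e 0 (K.piece 2 J y'') (K.σ w) + S'.e 1 (K.piece 2 J y'') (K.σ w))) := by
        rw [hsplit]
    _ ≤ max (Cα α) 0 * Real.exp (-(δ / 2 * S₀.dist y y')) * S₀.cutH α ζ * S₀.supNorm J +
        (max (Cα α) 0 * P * Λ * Real.exp (-(δ / 2 * S₀.dist y y')) *
          S₀.cutH α ζ * S₀.supNorm J +
        Dh * S₀.cutH α ζ * (2 * Nn * (C₁ * Real.exp (δ₁ * r0)) * P * Λ *
          Real.exp (-(δ / 2 * S₀.dist y y')) * S₀.supNorm J)) :=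
        add_le_add (hmain.trans (step1.trans step2)) (add_le_add hA hB')
    _ = _ := by ring

/-- **(1.112) for G from (1.112) and (1.110) for G₀ and the piece decay**, one instance, with explicit constant
ε ↦ max(Cε(ε),0) + C₁·P·Λ and rate ½δ (δ also ≤ the second-order rate δ₃ of G₀; Λ ≥ 0).
[cite: Balaban1984PropagatorsI, (1.132) p.39, (1.112) p.35] -/
theorem e4Entry_of_pieces (Mf : MapFacts K r0 Nn) (hPD : PieceDecay K P δp) (hP0 : 0 ≤ P)
    (Dp : Display133 K Dh) (Sg' : ModelSigns S') (Sg₀ : ModelSigns S₀) {Cε : ℝ → ℝ} {C₁ δ₁ δ₃ δ Λ : ℝ}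
    (hC₁ : 0 ≤ C₁) (hδ : 0 ≤ δ) (hΛ : 0 ≤ Λ) (h1 : δ ≤ δ₁) (h2 : δ ≤ δp) (h3 : δ ≤ δ₃)
    (He : ∀ n, SupEntry S' n C₁ δ₁) (He4 : E4Entry S' Cε δ₃) (row : URow K (δ / 2) Λ) :
    E4Entry S₀ (fun ε => max (Cε ε) 0 + C₁ * P * Λ) (δ / 2) := by
  intro ε J y y' hε0 hε1 hs
  have hCe0 : 0 ≤ max (Cε ε) 0 := le_max_right _ _
  have hmain := He4 ε (K.ι J) (K.σ y) (K.σ y') hε0 hε1 (Mf.supp_map J y' hs)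
  have hD : Real.exp (-(δ₃ * S'.dist (K.σ y) (K.σ y'))) ≤ Real.exp (-(δ / 2 * S₀.dist y y')) :=
    decay_transfer hδ h3 (Sg₀.dist_nonneg y y') (Mf.dist_le y y')
  have hN' : 0 ≤ S'.holder ε (K.ι J) + S'.supNorm (K.ι J) :=
    add_nonneg (Sg'.holder_nonneg _ _) (Sg'.supNorm_nonneg _)
  have step1 : Cε ε * Real.exp (-(δ₃ * S'.dist (K.σ y) (K.σ y'))) * (S'.holder ε (K.ι J) + S'.supNorm (K.ι J)) ≤
      max (Cε ε) 0 * Real.exp (-(δ₃ * S'.dist (K.σ y) (K.σ y'))) * (S'.holder ε (K.ι J) + S'.supNorm (K.ι J)) :=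
    mul_le_mul_of_nonneg_right (mul_le_mul_of_nonneg_right (le_max_left _ _) (Real.exp_nonneg _)) hN'
  have step2 : max (Cε ε) 0 * Real.exp (-(δ₃ * S'.dist (K.σ y) (K.σ y'))) *
      (S'.holder ε (K.ι J) + S'.supNorm (K.ι J)) ≤
      max (Cε ε) 0 * Real.exp (-(δ / 2 * S₀.dist y y')) * (S₀.holder ε J + S₀.supNorm J) :=
    mono3 hCe0 hD (Real.exp_nonneg _) (add_le_add (Mf.holder_map ε J) (Mf.supNorm_map J)) hN'
  have hsum := sum_sup_piece_decay K Mf hPD hP0 Sg' Sg₀ hC₁ hδ h1 h2 1 2 (He 1) row J y y' hs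
  have hc0 : 0 ≤ C₁ * P * Λ * Real.exp (-(δ / 2 * S₀.dist y y')) := by
    positivity
  have hsum' : C₁ * P * Λ * Real.exp (-(δ / 2 * S₀.dist y y')) *
      S₀.supNorm J ≤ C₁ * P * Λ * Real.exp (-(δ / 2 * S₀.dist y y')) *
      (S₀.holder ε J + S₀.supNorm J) :=
    mul_le_mul_of_nonneg_left (le_add_of_nonneg_left (Sg₀.holder_nonneg ε J)) hc0
  calc S₀.e4 J y ≤ _ := Dp.e4 J y
    _ ≤ max (Cε ε) 0 * Real.exp (-(δ / 2 * S₀.dist y y')) * (S₀.holder ε J + S₀.supNorm J) +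
        C₁ * P * Λ * Real.exp (-(δ / 2 * S₀.dist y y')) *
          (S₀.holder ε J + S₀.supNorm J) :=
        add_le_add (hmain.trans (step1.trans step2)) (hsum.trans hsum')
    _ = _ := by ring

/-- **(1.113) for G from (1.113) and (1.111) for G₀ and the piece decay**, one instance, with explicit constant
(α, ε) ↦ max(Cαε(α,ε),0) + max(Cα(α),0)·P·Λ and rate ½δ.
[cite: Balaban1984PropagatorsI, (1.132) p.39, (1.113) p.35] -/
theorem h2Entry_of_pieces (Mf : MapFacts K r0 Nn) (hPD : PieceDecay K P δp) (hP0 : 0 ≤ P)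
    (Dp : Display133 K Dh) (Sg' : ModelSigns S') (Sg₀ : ModelSigns S₀) {Cα : ℝ → ℝ} {Cαε : ℝ → ℝ → ℝ}
    {δ₁ δ₃ δ Λ : ℝ} (hδ : 0 ≤ δ) (hΛ : 0 ≤ Λ) (h1 : δ ≤ δ₁) (h2 : δ ≤ δp) (h3 : δ ≤ δ₃)
    (Hh1 : H1Entry S' Cα δ₁) (Hh2 : H2Entry S' Cαε δ₃) (row : URow K (δ / 2) Λ) :
    H2Entry S₀ (fun α ε => max (Cαε α ε) 0 + max (Cα α) 0 * P * Λ)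
      (δ / 2) := by
  intro α ε J ζ y y' hα0 hε0 hαε hζ hs
  have hα1 : α < 1 := by linarith
  have hCa0 : 0 ≤ max (Cαε α ε) 0 := le_max_right _ _
  have hmain := Hh2 α ε (K.ι J) (K.κ ζ) (K.σ y) (K.σ y') hα0 hε0 hαε (Mf.cut_map ζ y hζ)
    (Mf.supp_map J y' hs)
  have hD : Real.exp (-(δ₃ * S'.dist (K.σ y) (K.σ y'))) ≤ Real.exp (-(δ / 2 * S₀.dist y y')) :=
    decay_transfer hδ h3 (Sg₀.dist_nonneg y y') (Mf.dist_le y y')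
  have hN' : 0 ≤ S'.holder (α + ε) (K.ι J) + S'.supNorm (K.ι J) :=
    add_nonneg (Sg'.holder_nonneg _ _) (Sg'.supNorm_nonneg _)
  have step1 : Cαε α ε * Real.exp (-(δ₃ * S'.dist (K.σ y) (K.σ y'))) * S'.cutH α (K.κ ζ) *
      (S'.holder (α + ε) (K.ι J) + S'.supNorm (K.ι J)) ≤
      max (Cαε α ε) 0 * Real.exp (-(δ₃ * S'.dist (K.σ y) (K.σ y'))) * S'.cutH α (K.κ ζ) *
      (S'.holder (α + ε) (K.ι J) + S'.supNorm (K.ι J)) :=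
    mul_le_mul_of_nonneg_right (mul_le_mul_of_nonneg_right (mul_le_mul_of_nonneg_right (le_max_left _ _)
      (Real.exp_nonneg _)) (Sg'.cutH_nonneg _ _)) hN'
  have step2 : max (Cαε α ε) 0 * Real.exp (-(δ₃ * S'.dist (K.σ y) (K.σ y'))) * S'.cutH α (K.κ ζ) *
      (S'.holder (α + ε) (K.ι J) + S'.supNorm (K.ι J)) ≤
      max (Cαε α ε) 0 * Real.exp (-(δ / 2 * S₀.dist y y')) * S₀.cutH α ζ *
      (S₀.holder (α + ε) J + S₀.supNorm J) :=
    mono4 hCa0 hD (Real.exp_nonneg _) (Mf.cutH_map α ζ) (Sg'.cutH_nonneg _ _)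
      (add_le_add (Mf.holder_map _ J) (Mf.supNorm_map J)) hN'
  have hsum := sum_h1_piece_decay K Mf hPD hP0 Sg' Sg₀ hδ h1 h2 2 Hh1 row α J ζ y y' hα0 hα1 hζ hs
  have hc0 : 0 ≤ max (Cα α) 0 * P * Λ *
      Real.exp (-(δ / 2 * S₀.dist y y')) * S₀.cutH α ζ := by
    have := Sg₀.cutH_nonneg α ζ; positivity
  have hsum' : max (Cα α) 0 * P * Λ *
      Real.exp (-(δ / 2 * S₀.dist y y')) * S₀.cutH α ζ * S₀.supNorm J ≤
      max (Cα α) 0 * P * Λ *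
      Real.exp (-(δ / 2 * S₀.dist y y')) * S₀.cutH α ζ * (S₀.holder (α + ε) J + S₀.supNorm J) :=
    mul_le_mul_of_nonneg_left (le_add_of_nonneg_left (Sg₀.holder_nonneg _ J)) hc0
  calc S₀.h2 J α ζ ≤ _ := Dp.h2 J α ζ y hζ
    _ ≤ max (Cαε α ε) 0 * Real.exp (-(δ / 2 * S₀.dist y y')) * S₀.cutH α ζ *
          (S₀.holder (α + ε) J + S₀.supNorm J) +
        max (Cα α) 0 * P * Λ *
          Real.exp (-(δ / 2 * S₀.dist y y')) * S₀.cutH α ζ * (S₀.holder (α + ε) J + S₀.supNorm J) :=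
        add_le_add (hmain.trans (step1.trans step2)) (hsum.trans hsum')
    _ = _ := by ring

end Instance


/-! ## §3. Families: the printed sentence «… implies immediately … Proposition 1.2 for G», derived -/

section Family

variable {I : Type} (famG0 fam : I → B5.Setting) (Kf : ∀ i, Carrier133 (famG0 i) (fam i)) {r0 Nn Dh : ℝ}

/-- **First-order entries of G from those of G₀ and a uniform piece decay.** (1.110)–(1.111) uniformly for the
family G (`FirstOrderFam fam`) from (1.110)–(1.111) uniformly for G₀ (`FirstOrderFam famG0`) and piece decay with
family-uniform constant and rate, through the located leaves `MapFacts`, `Display133`, `URow`.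
Rate: half the minimum of the two input rates. [cite: Balaban1984PropagatorsI, (1.132) p.39] -/
theorem firstOrder_of_pieces (Mf : ∀ i, MapFacts (Kf i) r0 Nn) (Dp : ∀ i, Display133 (Kf i) Dh)
    (SgG0 : ∀ i, ModelSigns (famG0 i)) (SgG : ∀ i, ModelSigns (fam i))
    (hRow : ∀ κ : ℝ, 0 < κ → ∃ Λ : ℝ, ∀ i, URow (Kf i) κ Λ) {P δp : ℝ} (hP0 : 0 ≤ P) (hδp : 0 < δp)
    (hPD : ∀ i, PieceDecay (Kf i) P δp) (h1 : FirstOrderFam famG0) : FirstOrderFam fam := by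
  obtain ⟨δ₁, C₁, Cα, hδ₁, hC₁, H1⟩ := h1
  obtain ⟨δ, hδ, hd1, hd2⟩ : ∃ δ : ℝ, 0 < δ ∧ δ ≤ δ₁ ∧ δ ≤ δp :=
    ⟨min δ₁ δp, lt_min hδ₁ hδp, min_le_left _ _, min_le_right _ _⟩
  obtain ⟨Λ₀, HΛ₀⟩ := hRow (δ / 2) (half_pos hδ)
  -- a non-negative row-sum constant
  obtain ⟨Λ, hΛ0, HΛ⟩ : ∃ Λ : ℝ, 0 ≤ Λ ∧ ∀ i, URow (Kf i) (δ / 2) Λ :=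
    ⟨max Λ₀ 0, le_max_right _ _, fun i y => (HΛ₀ i y).trans (le_max_left _ _)⟩
  refine ⟨δ / 2, max (C₁ + C₁ * P * Λ) C₁,
    fun α => max (Cα α) 0 + max (Cα α) 0 * P * Λ + Dh * (2 * Nn * (C₁ * Real.exp (δ₁ * r0)) * P * Λ),
    half_pos hδ, lt_max_of_lt_right hC₁, fun i => ⟨fun n => ?_, ?_⟩⟩
  · intro J y y' hs
    exact B9FromB6.weaken3 (supEntry_of_pieces (Kf i) (Mf i) (hPD i) hP0 (Dp i) (SgG0 i) (SgG i) hC₁.le hδ.le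
      hd1 hd2 (H1 i).1 (HΛ i) n J y y' hs) (le_max_left _ _) (hC₁.le.trans (le_max_right _ _))
      ((SgG i).supNorm_nonneg J) le_rfl ((SgG i).dist_nonneg y y')
  · exact h1Entry_of_pieces (Kf i) (Mf i) (hPD i) hP0 (Dp i) (SgG0 i) (SgG i) hC₁.le hδ.le hd1 hd2 (H1 i).1
      (H1 i).2 (HΛ i)

/-- **Second-order entries of G from the entries of G₀ and a uniform piece decay.** (1.112)–(1.113) uniformly for
G from (1.110)–(1.113) uniformly for G₀ and the piece decay, through the same located leaves.  Rate: half the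
minimum of the three input rates. [cite: Balaban1984PropagatorsI, (1.132) p.39] -/
theorem secondOrder_of_pieces (Mf : ∀ i, MapFacts (Kf i) r0 Nn) (Dp : ∀ i, Display133 (Kf i) Dh)
    (SgG0 : ∀ i, ModelSigns (famG0 i)) (SgG : ∀ i, ModelSigns (fam i))
    (hRow : ∀ κ : ℝ, 0 < κ → ∃ Λ : ℝ, ∀ i, URow (Kf i) κ Λ) {P δp : ℝ} (hP0 : 0 ≤ P) (hδp : 0 < δp)
    (hPD : ∀ i, PieceDecay (Kf i) P δp) (h1 : FirstOrderFam famG0) (h2 : SecondOrderFam famG0) :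
    SecondOrderFam fam := by
  obtain ⟨δ₁, C₁, Cα, hδ₁, hC₁, H1⟩ := h1
  obtain ⟨δ₃, Cε, Cαε, hδ₃, H2⟩ := h2
  obtain ⟨δ, hδ, hd1, hd2, hd3⟩ : ∃ δ : ℝ, 0 < δ ∧ δ ≤ δ₁ ∧ δ ≤ δp ∧ δ ≤ δ₃ :=
    ⟨min δ₁ (min δp δ₃), lt_min hδ₁ (lt_min hδp hδ₃), min_le_left _ _,
      (min_le_right _ _).trans (min_le_left _ _), (min_le_right _ _).trans (min_le_right _ _)⟩
  obtain ⟨Λ₀, HΛ₀⟩ := hRow (δ / 2) (half_pos hδ)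
  obtain ⟨Λ, hΛ0, HΛ⟩ : ∃ Λ : ℝ, 0 ≤ Λ ∧ ∀ i, URow (Kf i) (δ / 2) Λ :=
    ⟨max Λ₀ 0, le_max_right _ _, fun i y => (HΛ₀ i y).trans (le_max_left _ _)⟩
  refine ⟨δ / 2, fun ε => max (Cε ε) 0 + C₁ * P * Λ, fun α ε => max (Cαε α ε) 0 + max (Cα α) 0 * P * Λ,
    half_pos hδ, fun i => ⟨?_, ?_⟩⟩
  · exact e4Entry_of_pieces (Kf i) (Mf i) (hPD i) hP0 (Dp i) (SgG0 i) (SgG i) hC₁.le hδ.le hΛ0 hd1 hd2 hd3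
      (H1 i).1 (H2 i).1 (HΛ i)
  · exact h2Entry_of_pieces (Kf i) (Mf i) (hPD i) hP0 (Dp i) (SgG0 i) (SgG i) hδ.le hΛ0 hd1 hd2 hd3 (H1 i).2
      (H2 i).2 (HΛ i)

/-- **Uniform piece decay from the leaf (1.126) and (1.114) for G.**  From `B5.Kernel126_127Printed Kd` (its first
conjunct (1.126), family-uniform δ′₀ and C) and `B5.Local114Fam fam`, through `PieceFacts132` (blockwise
Cauchy–Schwarz), `MapFacts` (triangle inequality) and `URow`: a family-uniform constant P ≥ 0 and rate δp > 0.
[cite: Balaban1984PropagatorsI, (1.132) p.39, (1.126) p.38, (1.114) p.36] -/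
theorem pieceDecay_fam (Kd : I → B5.KernelData) (Kc : ∀ i, KerCarrier (Kd i) (fam i)) {A B c₀ : ℝ}
    (Mf : ∀ i, MapFacts (Kf i) r0 Nn) (Pf : ∀ i, PieceFacts132 (Kf i) (Kc i) A B c₀)
    (SgG : ∀ i, ModelSigns (fam i)) (hRow : ∀ κ : ℝ, 0 < κ → ∃ Λ : ℝ, ∀ i, URow (Kf i) κ Λ)
    (hleaf : B5.Kernel126_127Printed Kd) (h3 : B5.Local114Fam fam) :
    ∃ P δp : ℝ, 0 ≤ P ∧ 0 < δp ∧ ∀ i, PieceDecay (Kf i) P δp := by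
  obtain ⟨δ₀', C, Cα, hδ₀', hC, HK⟩ := hleaf
  obtain ⟨δ₂, C₂, hδ₂, hC₂, H3⟩ := (local114Fam_iff fam).mp h3
  obtain ⟨δ, hδ, hd1, hd2⟩ : ∃ δ : ℝ, 0 < δ ∧ δ ≤ δ₀' ∧ δ ≤ δ₂ :=
    ⟨min δ₀' δ₂, lt_min hδ₀' hδ₂, min_le_left _ _, min_le_right _ _⟩
  obtain ⟨Λ, HΛ⟩ := hRow (δ / 2) (half_pos hδ)
  refine ⟨max (A * (C * Real.exp (δ₀' * c₀)) * C₂ * B * Λ) 0, δ / 2, le_max_right _ _, half_pos hδ, fun i => ?_⟩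
  exact pieceDecay_mono (Kf i) (SgG i)
    (pieceDecay_of_kernel (Kf i) (Mf i) (Pf i) (SgG i) hC.le hC₂.le hδ.le hd1 hd2 (HK i).1 (H3 i) (HΛ i))
    (le_max_left _ _)

/-- **Sup / Hölder transfer G₀ ↝ G.** `FirstOrderFam famG0 → SecondOrderFam famG0 → B5.Local114Fam fam →
FirstOrderFam fam ∧ SecondOrderFam fam`, given the leaf (1.126)–(1.127): the (1.110)–(1.113) half of «This together
with the properties (1.126), (1.127) of ∂P∂* and … (1.114) for the operator G implies immediately … Proposition 1.2
for G». [cite: Balaban1984PropagatorsI, (1.132) p.39] -/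
theorem transfer_of_display132 (Kd : I → B5.KernelData) (Kc : ∀ i, KerCarrier (Kd i) (fam i)) {A B c₀ : ℝ}
    (Mf : ∀ i, MapFacts (Kf i) r0 Nn) (Pf : ∀ i, PieceFacts132 (Kf i) (Kc i) A B c₀)
    (Dp : ∀ i, Display133 (Kf i) Dh) (SgG0 : ∀ i, ModelSigns (famG0 i)) (SgG : ∀ i, ModelSigns (fam i))
    (hRow : ∀ κ : ℝ, 0 < κ → ∃ Λ : ℝ, ∀ i, URow (Kf i) κ Λ) (hleaf : B5.Kernel126_127Printed Kd) :
    FirstOrderFam famG0 → SecondOrderFam famG0 → B5.Local114Fam fam →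
      FirstOrderFam fam ∧ SecondOrderFam fam := by
  intro h1 h2 h3
  obtain ⟨P, δp, hP0, hδp, hPD⟩ := pieceDecay_fam famG0 fam Kf Kd Kc Mf Pf SgG hRow hleaf h3
  exact ⟨firstOrder_of_pieces famG0 fam Kf Mf Dp SgG0 SgG hRow hP0 hδp hPD h1,
    secondOrder_of_pieces famG0 fam Kf Mf Dp SgG0 SgG hRow hP0 hδp hPD h1 h2⟩

/-- **The printed sentence, second pairing: «We will prove … the whole Proposition 1.2, for the operator G₀. This
together with the properties (1.126), (1.127) of ∂P∂* and … (1.114) for the operator G implies immediately …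
Proposition 1.2 for G.»**  Literally `B5.Prop12Printed famG0 → B5.Kernel126_127Printed Kd → B5.Local114Fam fam →
B5.Prop12Printed fam`, from the located leaves `MapFacts`, `PieceFacts132`, `Display133` ((1.132) entrywise),
`URow` and the model signs; the fifth block (1.114) of Prop. 1.2 for G is the hypothesis itself.  This is the pair of
slots `S2`, `S1` of `B5.prop12_of_printed_steps` in the paper's own alternative form (no global bounds
(1.115)–(1.117), no second random-walk expansion). [cite: Balaban1984PropagatorsI, (1.132) p.39] -/
theorem prop12_of_G0_via132 (Kd : I → B5.KernelData) (Kc : ∀ i, KerCarrier (Kd i) (fam i)) {A B c₀ : ℝ}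
    (Mf : ∀ i, MapFacts (Kf i) r0 Nn) (Pf : ∀ i, PieceFacts132 (Kf i) (Kc i) A B c₀)
    (Dp : ∀ i, Display133 (Kf i) Dh) (SgG0 : ∀ i, ModelSigns (famG0 i)) (SgG : ∀ i, ModelSigns (fam i))
    (hRow : ∀ κ : ℝ, 0 < κ → ∃ Λ : ℝ, ∀ i, URow (Kf i) κ Λ) :
    B5.Prop12Printed famG0 → B5.Kernel126_127Printed Kd → B5.Local114Fam fam → B5.Prop12Printed fam := by
  intro hG0 hleaf h3
  obtain ⟨h1, h2, -⟩ := blocks_of_prop12 famG0 hG0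
  obtain ⟨h1', h2'⟩ := transfer_of_display132 famG0 fam Kf Kd Kc Mf Pf Dp SgG0 SgG hRow hleaf h1 h2 h3
  exact prop12_of_blocks fam SgG h1' h2' h3

end Family


/-! ## §4. Corollaries: Prop. 1.2 for G from its printed steps without the slots S2, S1; the whole B4 → B5 chain -/

section Corollary

open B5Ineq137 B5Ineq113 B5Ineq110Gp

/-- **`B5.prop12_of_printed_steps` with the slots S2 and S1 (and the global Hölder data `g`) removed**: Prop. 1.2
for G from Prop. 1.1 for G (`h11`), the leaf (1.126)–(1.127) (`hleaf`), the printed step S1′ «the proof of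
inequalities (1.114) … is completed because we have proved inequalities (1.89)» (`S1'`, the L² random-walk
expansion, a printed sentence kept as the named hypothesis it is) and S3 = Prop. 1.2 for G₀ (`S3`), through the
located leaves of the (1.132) transfer. [cite: Balaban1984PropagatorsI, pp.36–40] -/
theorem prop12_via132_of_printed_steps {I : Type} (fam famG0 : I → B5.Setting) (Kd : I → B5.KernelData)
    (h11 : B5.Prop11Printed fam) (hleaf : B5.Kernel126_127Printed Kd)
    (S1' : B5.Prop11Printed fam → B5.Kernel126_127Printed Kd → B5.Local114Fam fam)
    (S3 : B5.Prop12Printed famG0)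
    (Kf : ∀ i, Carrier133 (famG0 i) (fam i)) (Kc : ∀ i, KerCarrier (Kd i) (fam i)) {A B c₀ r0 Nn Dh : ℝ}
    (Mf : ∀ i, MapFacts (Kf i) r0 Nn) (Pf : ∀ i, PieceFacts132 (Kf i) (Kc i) A B c₀)
    (Dp : ∀ i, Display133 (Kf i) Dh) (SgG0 : ∀ i, ModelSigns (famG0 i)) (SgG : ∀ i, ModelSigns (fam i))
    (hRow : ∀ κ : ℝ, 0 < κ → ∃ Λ : ℝ, ∀ i, URow (Kf i) κ Λ) :
    B5.Prop12Printed fam :=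
  prop12_of_G0_via132 famG0 fam Kf Kd Kc Mf Pf Dp SgG0 SgG hRow S3 hleaf (S1' h11 hleaf)

/-- **The whole B4 → B5 chain for Proposition 1.2 ((1.110)–(1.114)) for G = G(Ω)**, every unprinted reduction now
kernel arithmetic over located leaves: S3 = Prop. 1.2 for G₀ by `B5Transfer133.prop12G0_of_B4_via133` (B4's
Theorem (printed dependence) and Lemma 2.4 BY NAME, the located displays (1.135)–(1.137), (2.35)–(2.37), (1.133)
entrywise, dictionaries and model-evident facts, and the printed sentences `h11G0`, `h114G0` about G₀), then the
(1.132) transfer of this module.  The hypotheses standing for PRINTED MATHEMATICS NOT FORMALISED are exactly: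
`hThm`, `h24` (B4 as printed), `h11G0`, `h114G0`, `h11`, `S1'` (Prop. 1.1 and the L² random-walk expansions of
Sect. E for G₀ and for G), `hleaf` ((1.126)–(1.127), B4's method); everything else is a located leaf or a sign fact.
[cite: Balaban1984PropagatorsI, pp.36–40] -/
theorem prop12_of_B4_via132 {I I₄ I₂₄ : Type} (fam₄ : I₄ → B4.EtaSetting)
    (fam₂₄ : I₂₄ → B4.ScaleSetting) (fam famGp famG0 : I → B5.Setting) (Kd : I → B5.KernelData)
    (F : ∀ i, B5FromB4.GpHolder (famGp i)) (c : ℝ) (ι : I → ℝ → I₄)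
    (Dι : ∀ (i : I) (e : ℝ), 0 < e → B5FromB4.Dict (fam₄ (ι i e)) (famGp i) (F i) c e)
    (SgGp : ∀ i, B5FromB4.ModelSigns (famGp i)) (SgG0 : ∀ i, B5FromB4.ModelSigns (famG0 i))
    (SgG : ∀ i, B5FromB4.ModelSigns (fam i))
    (hThm : B5FromB4.ThmDepPrinted fam₄) (h24 : B4.Lemma24Printed fam₂₄)
    (Dfam : ∀ i, ScaleData (famGp i)) (Pfam : ∀ i, GpData (Dfam i)) (L : ℝ) (d : ℕ)
    (cc cb ā aK s₀ pL : ℝ) (hL : 1 < L) (hs₀ : 0 ≤ s₀) (hpL : 0 ≤ pL) (haK : 0 ≤ aK)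
    (ha : ∀ i j, |(Dfam i).a j| ≤ ā)
    (h136 : ∀ i, Display136 (Dfam i) L d) (Z : ∀ i, RowZero (Dfam i))
    (h135R : ∀ i, Display135 (dataR (Dfam i) (Pfam i)) L d 1)
    (h135Z : ∀ i, Display135 (dataZ (Dfam i) (Pfam i)) L d 2)
    (D24 : ∀ i, Dict24 fam₂₄ (Dfam i) L s₀) (D236 : ∀ i, Dict236 fam₂₄ (Dfam i) L)
    (D24G : ∀ i, Dict24Gp fam₂₄ (Dfam i) (Pfam i) L s₀ pL)
    (Lap : ∀ i, LaplaceLeaf (Dfam i) (Pfam i) aK cb)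
    (Dc : ∀ i, Dict137 (Dfam i) d) (Dc' : ∀ i, Dict113 (Dfam i) d)
    (DG : ∀ i, DictGp (Dfam i) (Pfam i) (F i) d)
    (G : ∀ i, Geometry (Dfam i) L cc) (G' : ∀ i, Geometry113 (Dfam i) L)
    (hRow : ∀ κ : ℝ, 0 < κ → ∃ R Λ : ℝ, ∀ i, RowSums (Dfam i) L d κ R Λ)
    (N : ∀ i, NormFacts (Dfam i))
    (h11G0 : B5.Prop11Printed famG0)
    (h114G0 : B5.Prop11Printed famG0 → B5.Local114Fam famG0)
    (Kf : ∀ i, Carrier133 (famGp i) (famG0 i)) {A B r0 Nn Dh : ℝ}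
    (Fk : ∀ i, CarrierFacts (Kf i) A B r0 Nn) (Dp : ∀ i, Display133 (Kf i) Dh)
    (hRowU : ∀ κ : ℝ, 0 < κ → ∃ Λ : ℝ, ∀ i, URow (Kf i) κ Λ)
    (h11 : B5.Prop11Printed fam) (hleaf : B5.Kernel126_127Printed Kd)
    (S1' : B5.Prop11Printed fam → B5.Kernel126_127Printed Kd → B5.Local114Fam fam)
    (Kg : ∀ i, Carrier133 (famG0 i) (fam i)) (Kc : ∀ i, KerCarrier (Kd i) (fam i))
    {A₂ B₂ c₀ r₂ N₂ D₂ : ℝ} (Mg : ∀ i, MapFacts (Kg i) r₂ N₂) (Pg : ∀ i, PieceFacts132 (Kg i) (Kc i) A₂ B₂ c₀)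
    (Dg : ∀ i, Display133 (Kg i) D₂) (hRowG : ∀ κ : ℝ, 0 < κ → ∃ Λ : ℝ, ∀ i, URow (Kg i) κ Λ) :
    B5.Prop12Printed fam :=
  prop12_via132_of_printed_steps fam famG0 Kd h11 hleaf S1'
    (prop12G0_of_B4_via133 fam₄ fam₂₄ famGp famG0 F c ι Dι SgGp SgG0 hThm h24 Dfam Pfam L d cc cb ā aK s₀ pL
      hL hs₀ hpL haK ha h136 Z h135R h135Z D24 D236 D24G Lap Dc Dc' DG G G' hRow N h11G0 h114G0 Kf Fk Dp hRowU)
    Kg Kc Mg Pg Dg SgG0 SgG hRowG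

end Corollary

end Literature.MathematicalPhysics.QuantumFieldTheory.Balaban1983to89.B5Transfer132
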